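import Summits.NavierStokesRegularity.NavierStokesRegularity.Theorems.ExtremiserTransienceRegularisedSliceTransfer
import Summits.NavierStokesRegularity.NavierStokesRegularity.Theorems.ExtremiserTransienceBangBangCoreDefs
import Literature.Analysis.Calculus.AnalyticOfFDerivBound
import HarnessLib

/-!
# Crux `NearExtremalTransience` workfile (stmt-NavierStokesRegularity-21883) — LINE g11-β «extremal law»
# (seat ns-idea-10 g11, lens «rescuer»): a CHECKED SKELETON concluding BY NAME the crux
# `NearExtremalTransiencePerFlow` (stmt-NavierStokesRegularity-26567) through the ANALYTIC-BUDGET case of the open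
# third of its split, `RegularisedNearPlateauStability` (28317), and the landed `plateauSliceRigidity` (27823).

NO SUMMIT IS PROVED BY A LINE.  REV 1.1: R2 `AnalyticRigidity` PROVED (`analyticRigidity_holds`, from the tree's
`Literature.Analysis.Calculus.analyticOnNhd_of_norm_iteratedFDeriv_le` — real-analyticity from factorial derivative bounds,
Krantz–Parks Prop. 2.2.10 — and the identity principle for the analytic function `‖w‖²`, as in the landed ε = 0 theorem
`KStar.not_attained_of_analyticOnNhd`) and R3 `FullBallTransfer` PROVED (`fullBallTransfer_holds`: locally uniform convergence
+ `EuclideanSpace.volume_ball_fin_three`).  REV 1.2 (critic V137 PASS-WITH-PRICE B+, PRICE P1 + notes N1–N3 answered): the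
MEMBER-LEVEL ROOTED CONTACT INEQUALITY is TYPED and REGISTERED as the line's first lemma `RootedContact` (P1, §0′: one
admissible non-degenerate `A`-regular near-extremal field; the enstrophy fraction of roots at which the first variation `ell`
along the rooted, cut-off, drift-corrected ascent direction `rootedDir` exceeds `c` times the cell-intrinsic unit
`(2κ⋆M√Z√W)(κ⋆M√Z_x√W_x)` is at least `c`) and R1 is RE-CUT as P1 + R1′ `LawBookkeeping : RootedContact → MeanContact`;
`MeanContact` is restricted to analytic-type budgets (N2; costs nothing downstream); `push_neg` → `push Not` (N1).  The only
`sorry`s are the THREE registered stubs P1 `stub_rootedContact` (L), R1′ `stub_lawBookkeeping` (XL → L/XL) and R4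
`stub_analyticSliceTransfer` (M/L); `stub_meanContact`, `stub_analyticRigidity`, `stub_fullBallTransfer` are kept under their
registered names as derived/proved terms; the compositions `analyticRNPS_of`, `NearExtremalTransiencePerFlow_of` and
`NearExtremalTransiencePerFlow_of_rooted` (P1 → R1′ → R4 ⇒ (26567) BY NAME) are kernel-checked.

THE CORPSE (ns-idea-5, line `analytic_gap`, Dead lines): «Compactness proof of a uniform gap: the limit Φ = Φ₀ + c may carry
a Galilean drift c ≠ 0 and infinite energy, so `not_attained_of_analyticOnNhd` does not apply to it — dropped»; barrier
«COMPACTNESS MODULO SYMMETRIES FAILS (Galilean boosts, infinite-energy limits, escaping cells)»; and the E0 heart of every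
bang-bang line («efficient core»: a ball with DEFINITE first-variation share — the scaling direction `v ↦ (1+s)v` cannot be
localised for free).  This seat's own attempt to repair compactness at the FIELD level (`exact_shadow`, this session) died
on the same rocks, sharpened: budget-respecting «solenoids» at scale `A₁λ` induce `O(M)` drift, and cooperative crystals
live in the regularised class at fixed `λ` (NOTES `## Barrier notes`).

THE DODGE — COMPACTNESS OF LAWS, CONTACT IN THE MEAN, ANALYTIC RIGIDITY.
* Root the near-attainers at an ENSTROPHY-TYPICAL point and pass to the limit LAW (Benjamini–Schramm / Alberti–Müller
  «Young measures on micropatterns»): laws of `A`-regular fields are automatically tight; escaping cells, dichotomy and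
  infinite energy are invisible to a rooted law; the efficiency `J²/(M²ZW) = E[a]²/E[b]` (`a = ⟨ω,Sω⟩/|ω|²`,
  `b = |∇ω|²/|ω|²` at the root) is a functional OF THE LAW, exact in the limit («no wasted palinstrophy»).
* First-order optimality IN THE MEAN (Poissonised local modifications at enstrophy-proportional density) localises
  pathwise: the constant-coefficient Euler–Lagrange density `G_w` vanishes on `{‖w‖ < 1}` for a.e. sample.
* CONTACT IN THE MEAN: the global ascent direction `w − c` (drift-corrected; the first variation along constants is zero)
  has a SUBLINEAR gauge around a typical root, so its cut-offs are admissible test fields with `o(1)` relative error; the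
  truncated first variation has mean `ā·E[Z_R] > 0` (mass transport + environment homogeneity = Cauchy–Schwarz equality on
  the re-rooting-invariant σ-algebra), while `∫⟨G_w, η_R⟩ = 0` if plateaux have empty interior a.s. — so SOME sample,
  hence some local limit of the near-attainers, has a plateau WITH INTERIOR (R1).  No plateau SIZE is ever quantified.
* ANALYTIC RIGIDITY replaces quantitative bang-bang: in an analytic-type budget `A_j ≤ C^{j+1} j!` the local limit is
  real-analytic and `‖w‖ ≡ 1` on all of `ℝ³` (identity theorem, R2); locally uniform convergence then fills the WHOLE ball
  `B(y_n, rλ_n)` with the near-top set (R3) — `c₀ = r = 1` serve every analytic budget.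
* The slices of a Type-I flow ARE of analytic type (Foias–Temam / Grujić–Kukavica radius `≳ √(ν(T−t)) ∼ λ`), so the
  landed transfer `RegularisedSliceTransfer_proof` re-runs at an analytic budget (R4) and `plateauSliceRigidity` closes.
What is NOT concluded: `RegularisedNearPlateauStability` for NON-quasianalytic budgets (there flat plateaux of
field-dependent size are not excluded by rigidity; that residue is the genuine bang-bang problem and is not needed by the
route's dynamic transfer, which instantiates the crux at ONE per-flow budget).
-/

noncomputable section

open scoped Topology InnerProductSpace RealInnerProductSpace ENNReal ContDiff
open MeasureTheory Filter Set Metric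
open Literature.Analysis.FluidPDE
open Summit.NavierStokesRegularity.NavierStokesRegularity.Theses.ExtremiserTransience
open Summit.NavierStokesRegularity.NavierStokesRegularity.Theorems.DepletionLadder.KStar
open Summit.NavierStokesRegularity.NavierStokesRegularity.Theorems.DepletionLadder.KStar.HalfSpace
open Summit.NavierStokesRegularity.NavierStokesRegularity.Theorems.DepletionLadder.KStar.BangBang

namespace Summit.NavierStokesRegularity.NavierStokesRegularity.Cruxes.NearExtremalTransience.ExtremalLaw

set_option linter.dupNamespace false
set_option linter.unusedVariables false

/-! ## §0 Vocabulary (over the tree's `kStar, Jst, Zen, Wpa` and `lam, IsAdm, IsReg`) -/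

/-- A derivative budget of ANALYTIC TYPE: `A_j ≤ C^{j+1} · j!`. -/
def IsAnalyticBudget (A : ℕ → ℝ) : Prop := ∃ C : ℝ, ∀ j : ℕ, A j ≤ C ^ (j + 1) * (Nat.factorial j : ℝ)

/-- LOCALLY UNIFORM CONVERGENCE of the normalised, re-centred members `x ↦ (M n)⁻¹ • v n (y n + L n • x)` to `w`. -/
def NormalisedLimit (v : ℕ → E3 → E3) (M L : ℕ → ℝ) (y : ℕ → E3) (w : E3 → E3) : Prop :=
  ∀ ρ ϑ : ℝ, 0 < ρ → 0 < ϑ → ∀ᶠ n in atTop, ∀ x ∈ Metric.closedBall (0 : E3) ρ,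
    ‖(M n)⁻¹ • v n (y n + L n • x) - w x‖ ≤ ϑ

/-- The ANALYTIC-BUDGET CASE of `RegularisedNearPlateauStability` (28317), written over the tree's abbreviations
(`IsAdm`, `IsReg`, `kStar`, `lam` — definitionally the crux's literal clauses, see `analyticRNPS_of_rnps`). -/
def AnalyticRNPS : Prop :=
  ∀ A : ℕ → ℝ, (∀ j, 1 ≤ A j) → IsAnalyticBudget A → ∃ c₀ r : ℝ, 0 < c₀ ∧ 0 < r ∧ ∀ δ : ℝ, 0 < δ → ∃ ε : ℝ, 0 < ε ∧
    ∀ (v : E3 → E3) (M B : ℝ), IsAdm v M B → IsReg A v M →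
      0 < M * Real.sqrt (Zen v) * Real.sqrt (Wpa v) →
      (kStar - ε) * M * Real.sqrt (Zen v) * Real.sqrt (Wpa v) ≤ |Jst v| →
        ∃ x₀ : E3, ENNReal.ofReal (c₀ * (r * lam v) ^ 3) ≤
          volume {x : E3 | x ∈ Metric.ball x₀ (r * lam v) ∧ (1 - δ) * M ≤ ‖v x‖}

/-- The weak one-slice PLATEAU OBJECT along Type-I singular flows failing per-flow depletion — VERBATIM the consequent
of the route item `RegularisedSliceTransfer` (28318), i.e. what `plateauSliceRigidity` (27823) refutes. -/
def SliceObject : Prop :=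
  ∀ (C ν T : ℝ), 0 < C → 0 < ν → 0 < T → ∀ (u : ℝ → EuclideanSpace ℝ (Fin 3) → EuclideanSpace ℝ (Fin 3)) (p : ℝ → EuclideanSpace ℝ (Fin 3) → ℝ), Literature.Analysis.FluidPDE.IsClassicalNSSolutionOn (Set.Ico 0 T) ν 0 u p → Literature.Analysis.FluidPDE.IsLerayHopfOn T ν 0 (u 0) u → Literature.Analysis.FluidPDE.HasRapidSpatialDecay (u 0) → (∀ᶠ t in 𝓝[<] T, ∀ x, Real.sqrt (T - t) * ‖u t x‖ ≤ C * Real.sqrt ν) → ¬ Literature.Analysis.FluidPDE.HasSmoothExtensionPast ν 0 u T → ¬ (∃ θ : ℝ, 0 ≤ θ ∧ θ < 1 ∧ ∀ κ : ℝ, (∀ (v : EuclideanSpace ℝ (Fin 3) → EuclideanSpace ℝ (Fin 3)) (M B : ℝ), ContDiff ℝ (⊤ : ℕ∞) v → Literature.Analysis.FluidPDE.VectorCalculus.IsDivFree v → (∀ x, ‖v x‖ ≤ M) → (∀ x, ‖fderiv ℝ v x‖ ≤ B) → (∫⁻ x, ‖iteratedFDeriv ℝ 0 v x‖ₑ ^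 2 < ⊤) → (∫⁻ x, ‖iteratedFDeriv ℝ 1 v x‖ₑ ^ 2 < ⊤) → (∫⁻ x, ‖iteratedFDeriv ℝ 2 v x‖ₑ ^ 2 < ⊤) → |∫ x, ⟪Literature.Analysis.FluidPDE.curl v x, fderiv ℝ v x (Literature.Analysis.FluidPDE.curl v x)⟫_ℝ| ≤ κ * M * Real.sqrt (∫ x, ‖Literature.Analysis.FluidPDE.curl v x‖ ^ 2) * Real.sqrt (∫ x, Literature.Analysis.FluidPDE.frobeniusNormSq (fderiv ℝ (Literature.Analysis.FluidPDE.curl v) x))) → ∃ t₁ ∈ Set.Ico 0 T, ∃ (k : ℝ → ℝ) (B : ℝ), Measurable k ∧ (∀ τ, 0 ≤ k τ ∧ k τ ≤ 1) ∧ (∀ t ∈ Set.Ico t₁ T, ∀ M : ℝ, (∀ x, ‖u t x‖ ≤ M) → |∫ x, ⟪Literature.Analysis.FluidPDE.curl (u t) x, fderiv ℝ (u t) x (Literature.Analysis.FluidPDE.curl (u t) x)⟫_ℝ| ≤ k t * M * Real.sqrt (∫ x, ‖Literature.Analysis.FluidPDE.curl (u t) x‖ ^ 2) * Real.sqrt (∫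 x, Literature.Analysis.FluidPDE.frobeniusNormSq (fderiv ℝ (Literature.Analysis.FluidPDE.curl (u t)) x))) ∧ (∀ t ∈ Set.Ico t₁ T, ∫ τ in t₁..t, k τ ^ 2 / (T - τ) ≤ (θ * κ) ^ 2 * Real.log ((T - t₁) / (T - t)) + B)) → ∃ (W : ℝ → EuclideanSpace ℝ (Fin 3) → EuclideanSpace ℝ (Fin 3)) (K t₀ m : ℝ), ContinuousOn (Function.uncurry W) (Set.Iio (0 : ℝ) ×ˢ Set.univ) ∧ (∀ s t : ℝ, s < t → t < 0 → ∀ x, W t x = Literature.Analysis.FluidPDE.heatFlow (W s) (t - s) x - Literature.Analysis.FluidPDE.oseenDuhamel 1 s W W t x) ∧ (∀ t : ℝ, t < 0 → ∀ x, Real.sqrt (-t) * ‖W t x‖ ≤ K) ∧ t₀ < 0 ∧ 0 < m ∧ (∀ y, ‖W t₀ y‖ ≤ m) ∧ 0 < MeasureTheory.volume {y : EuclideanSpace ℝ (Fin 3) | ‖W t₀ y‖ = m}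

/-! ## §0′ (REV 1.2) Rooted vocabulary for the member-level contact inequality P1 -/

/-- Local enstrophy of `v` on the ball `B(x, r)`. -/
def locZen (v : E3 → E3) (x : E3) (r : ℝ) : ℝ := ∫ y in Metric.ball x r, ‖curl v y‖ ^ 2

/-- Local palinstrophy of `v` on the ball `B(x, r)`. -/
def locWpa (v : E3 → E3) (x : E3) (r : ℝ) : ℝ := ∫ y in Metric.ball x r, frobeniusNormSq (fderiv ℝ (curl v) y)

/-- The root's GALILEAN DRIFT: the mean velocity of `v` on `B(x, r)`. -/
def locMean (v : E3 → E3) (x : E3) (r : ℝ) : E3 := ⨍ y in Metric.ball x r, v y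

/-- THE ROOTED, CUT-OFF, DRIFT-CORRECTED ASCENT DIRECTION at root `x` and length unit `ℓ` (the Taylor length `λ(v)` in
use), for a bump `χ` centred at `0` (`= 1` on `B̄(0, χ.rIn)`, supported in `B(0, χ.rOut)`, read in units of `ℓ`):
`φ_x = curl ( χ((· − x)/ℓ) · conePotential (v(x + ·) − c̄_x) (· − x) )` with `c̄_x` the mean of `v` on `B(x, χ.rOut·ℓ)`.
It is `C^∞_c`, divergence free, supported in `B(x, χ.rOut·ℓ)` and EQUALS `v − c̄_x` on `B(x, χ.rIn·ℓ)` (tree: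
`KStar.curl_conePotential`, `KStar.cutoff_field` — the ε = 0 proof's `φ_R`, re-rooted and drift-corrected). -/
def rootedDir (χ : ContDiffBump (0 : E3)) (v : E3 → E3) (x : E3) (ℓ : ℝ) : E3 → E3 :=
  curl fun y => χ (ℓ⁻¹ • (y - x)) • conePotential (fun z => v (x + z) - locMean v x (χ.rOut * ℓ)) (y - x)

/-- **P1 — ROOTED CONTACT INEQUALITY (member level; L; REV 1.2 = the critic's PRICE V137-P1, typed).**  The deterministic,
single-field statement that carries the positivity of «contact in the mean»: for every analytic-type budget `A` there are a
cut-off radius `R ≥ 1` (in Taylor units), a constant `c > 0` and a defect `ε₀ > 0` such that for EVERY admissible, `A`-regular,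
non-degenerate field `v` with efficiency `≥ κ⋆ − ε₀`, the roots `x` at which the first variation `ℓ_v` of `J² − κ⋆²M²ZW`
along the rooted cut-off drift-corrected ascent direction `φ_x` (radius `Rλ`, support `2Rλ`) is at least
`c · (2κ⋆ M √Z √W) · (κ⋆ M √Z_x √W_x)` — `c` times the CELL-INTRINSIC unit built from the local enstrophy/palinstrophy on
`B(x, 2Rλ)` (so that dilution into far-apart copies costs nothing: each copy is its own good root) — carry at least the
fraction `c` of the enstrophy: `c·Z ≤ ∫_{good roots} ‖ω‖²`.  Heuristic (units `M = λ = 1`): `ℓ_v(φ_x) ≈ 6J·J_x − 2κ⋆²(W Z_x + Z W_x)`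
`≥ 2κ⋆√(ZW)·(3e·e_x − κ⋆(λ/λ_x + λ_x/λ))·√(Z_x W_x)` with `e, e_x` the global/local efficiencies and `λ_x` the local Taylor
length; `Σ_x e_x √(Z_x W_x) = e √(ZW)` with `Σ Z_x = Z, Σ W_x = W` forces `e_x ≈ κ⋆` and `λ_x ≈ λ` on enstrophy-most roots when
`e ≥ κ⋆ − ε₀`, whence `3e e_x − 2κ⋆² ≈ κ⋆² > 0` there; cut-off and drift terms are `O(1/R)` relative (annulus terms
`⟨ω, (c̄ ⊗ ∇χ) ω⟩ ≲ Z_ann/R`).  It is what falsifier (b) / the DILUTE-GAP rig prints (column: enstrophy fraction of roots with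
`ℓ_v(φ_x) ≥ c·unit_x`), needs no laws, and fixes the rooting (F3) in the statement.  WHY IT MIGHT FAIL: enstrophy-typical roots
whose ball `B(x,2Rλ)` sees a massive annulus and an empty core (doubling failure of `‖ω‖²` at scale `Rλ`, not excluded by
`A`-regularity alone) could make the cut-off error non-perturbative on a set of roots of positive enstrophy fraction. -/
def RootedContact : Prop :=
  ∀ A : ℕ → ℝ, IsAnalyticBudget A →
    ∃ (R c ε₀ : ℝ), 1 ≤ R ∧ 0 < c ∧ 0 < ε₀ ∧
      ∀ χ : ContDiffBump (0 : E3), χ.rIn = R → χ.rOut = 2 * R →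
      ∀ (v : E3 → E3) (M B : ℝ), IsAdm v M B → IsReg A v M →
        0 < M * Real.sqrt (Zen v) * Real.sqrt (Wpa v) →
        (kStar - ε₀) * M * Real.sqrt (Zen v) * Real.sqrt (Wpa v) ≤ |Jst v| →
          c * Zen v ≤ ∫ x in {x : E3 |
              c * (2 * kStar * M * Real.sqrt (Zen v) * Real.sqrt (Wpa v)) *
                  (kStar * M * Real.sqrt (locZen v x (2 * R * lam v)) * Real.sqrt (locWpa v x (2 * R * lam v))) ≤
                ell v M (rootedDir χ v x (lam v))}, ‖curl v x‖ ^ 2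

/-! ## §1 The statements of the line (R1 = P1 + R1′ since REV 1.2; R2, R3 proved; R4) -/

/-- **R1 — CONTACT IN THE MEAN (the heart; XL).**  Every sequence of admissible, `A`-regular, non-degenerate fields with
efficiency defects `ε n → 0` has, after re-centring at suitable points and passing to a subsequence, a normalised local
limit `w` (smooth, `‖w‖ ≤ 1`, budget `‖Dʲw‖ ≤ A_j` at unit Taylor length) whose speed plateau `{‖w‖ = 1}` has NONEMPTY
INTERIOR.  [enstrophy-rooted limit law; exact in the mean; KKT in the mean ⇒ `G_w = 0` off the plateau a.s.; sublinear
gauge of `w − c` + mass transport ⇒ truncated first variation has positive mean ⇒ contact with positive probability.] -/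
def MeanContact : Prop :=
  ∀ A : ℕ → ℝ, (∀ j, 1 ≤ A j) → IsAnalyticBudget A →
    ∀ (v : ℕ → E3 → E3) (M B ε : ℕ → ℝ),
      (∀ n, IsAdm (v n) (M n) (B n)) → (∀ n, IsReg A (v n) (M n)) →
      (∀ n, 0 < M n * Real.sqrt (Zen (v n)) * Real.sqrt (Wpa (v n))) →
      Tendsto ε atTop (𝓝 0) →
      (∀ n, (kStar - ε n) * M n * Real.sqrt (Zen (v n)) * Real.sqrt (Wpa (v n)) ≤ |Jst (v n)|) →
        ∃ (φ : ℕ → ℕ) (y : ℕ → E3) (w : E3 → E3), StrictMono φ ∧ ContDiff ℝ (⊤ : ℕ∞) w ∧ (∀ x, ‖w x‖ ≤ 1) ∧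
          (∀ (j : ℕ) (x : E3), ‖iteratedFDeriv ℝ j w x‖ ≤ A j) ∧ (interior {x : E3 | ‖w x‖ = 1}).Nonempty ∧
          NormalisedLimit (fun n => v (φ n)) (fun n => M (φ n)) (fun n => lam (v (φ n))) y w

/-- **R1′ — LAW BOOKKEEPING (REV 1.2; XL → L/XL once P1 stands): `RootedContact → MeanContact`.**  The law-level half of
the old R1: enstrophy-rooted laws of the normalised re-rooted members are tight (parabolic budget), limits are EXACT in
the mean; (F1) uniform integrability of the cell-normalised rooted first variation transports P1's positive enstrophy
fraction of good roots to `P(ℓ_w(φ_R) ≥ c·unit) ≥ c`; (F2) for a re-rooting-stationary law the drift-corrected cone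
potential of `w − c̄` is sublinear, so `ℓ_w(φ_R)` IS the first variation along a compactly supported admissible direction
up to `o_R(1)`; (F4) KKT in the mean against the UNIVERSAL competitor class (`IsAdm` only; many roots modified at once,
second variation of the scale-free functional `O(1)` per cell) gives `G_w = 0` off the plateau `P`-a.s.; if the plateau had
empty interior a.s., continuity of `G_w` would force `ℓ_w ≡ 0` on `C^∞_c`-curls, contradicting (F1)+(F2).  A sample path in
the support is a local limit around suitable centres: `MeanContact`. -/
def LawBookkeeping : Prop := RootedContact → MeanContact

/-- **R2 — ANALYTIC RIGIDITY OF THE PLATEAU (M).**  In an analytic-type budget a smooth field with `‖w‖ ≤ 1` whose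
plateau has nonempty interior has `‖w‖ ≡ 1`.  [factorial derivative bounds ⇒ `w` real-analytic on `ℝ³`; `‖w‖² − 1` is
analytic and vanishes on an open set ⇒ identity theorem on the connected space `ℝ³`.] -/
def AnalyticRigidity : Prop :=
  ∀ (A : ℕ → ℝ) (w : E3 → E3), IsAnalyticBudget A → ContDiff ℝ (⊤ : ℕ∞) w →
    (∀ (j : ℕ) (x : E3), ‖iteratedFDeriv ℝ j w x‖ ≤ A j) → (∀ x, ‖w x‖ ≤ 1) →
    (interior {x : E3 | ‖w x‖ = 1}).Nonempty → ∀ x, ‖w x‖ = 1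

/-- **R3 — FULL-BALL TRANSFER (M; elementary).**  If the normalised re-centred members converge locally uniformly to a
field of constant speed `1`, then at any radius `r` and margin `δ` the member `v n` eventually has speed `≥ (1−δ)M n`
on the WHOLE ball `B(y n, r·L n)`, whose volume `(4π/3)(rL n)³` exceeds `(rL n)³`.  [uniform convergence on
`closedBall 0 r` with `ϑ = δ`; `EuclideanSpace.volume_ball`.] -/
def FullBallTransfer : Prop :=
  ∀ (v : ℕ → E3 → E3) (M L : ℕ → ℝ) (y : ℕ → E3) (w : E3 → E3) (r δ : ℝ),
    0 < r → 0 < δ → (∀ n, 0 < M n) → (∀ n, 0 < L n) →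
    NormalisedLimit v M L y w → (∀ x, ‖w x‖ = 1) →
      ∀ᶠ n in atTop, ENNReal.ofReal ((r * L n) ^ 3) ≤
        volume {x : E3 | x ∈ Metric.ball (y n) (r * L n) ∧ (1 - δ) * M n ≤ ‖v n x‖}

/-- **R4 — ANALYTIC SLICE TRANSFER (M/L).**  The analytic-budget case of the crux already produces the weak one-slice
plateau object along every Type-I singular flow failing per-flow depletion.  [re-run of the LANDED
`RegularisedSliceTransfer_proof` (28318) with its per-flow budget `A_j = max 1 (C_j Θ'^j / c_L)` certified of analytic
type: the higher Type-I rates `C_j` are of analytic type because the slices of a Type-I mild flow are space-analytic with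
radius `≳ √(ν(T−t))` (Foias–Temam 1989, Grujić–Kukavica 1998; tree: `typeI_mild_analyticOnNhd` is the qualitative form).] -/
def AnalyticSliceTransfer : Prop := AnalyticRNPS → SliceObject

/-! ## §2 Registered stubs (the only `sorry`s of the file: P1, R1′ and R4 — R1 is derived from P1 + R1′; R2 and R3 are PROVED since REV 1.1) -/

/-- P1 — rooted contact inequality (L; member level; REV 1.2, the critic's PRICE V137-P1). [folklore] -/
theorem stub_rootedContact : RootedContact := by
  sorry

/-- R1′ — law bookkeeping: `RootedContact → MeanContact` (XL → L/XL; REV 1.2 re-cut of R1). [folklore] -/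
theorem stub_lawBookkeeping : LawBookkeeping := by
  sorry

/-- R1 — contact in the mean, now DERIVED: P1 + R1′ (kept under its registered name; no `sorry` of its own). -/
theorem stub_meanContact : MeanContact := stub_lawBookkeeping stub_rootedContact

/-- **R2 PROVED (REV 1.1) — analytic rigidity of the plateau.**  Factorial derivative bounds make `w` real-analytic on `ℝ³`
(`analyticOnNhd_of_norm_iteratedFDeriv_le`, tree); `‖w‖² = Σᵢ wᵢ²` is analytic and equals `1` near an interior point of the
plateau, hence everywhere (identity principle on the connected space `ℝ³`). [folklore] -/
theorem analyticRigidity_holds : AnalyticRigidity := by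
  intro A w hAn hw hwA hw1 hint
  obtain ⟨C, hC⟩ := hAn
  -- real-analyticity from the factorial budget
  have han : AnalyticOnNhd ℝ w univ := by
    refine Literature.Analysis.Calculus.analyticOnNhd_of_norm_iteratedFDeriv_le (M := C) (C := C) isOpen_univ
      hw.contDiffOn fun k z _ => ?_
    calc ‖iteratedFDeriv ℝ k w z‖ ≤ A k := hwA k z
      _ ≤ C ^ (k + 1) * (Nat.factorial k : ℝ) := hC k
      _ = C * C ^ k * (Nat.factorial k : ℝ) := by ring
  obtain ⟨x₀, hx₀⟩ := hint
  -- `‖w‖² = Σᵢ wᵢ²` is analytic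
  have hsq : AnalyticOnNhd ℝ (fun x => ‖w x‖ ^ 2) univ := by
    have hcoord : ∀ i : Fin 3, AnalyticOnNhd ℝ (fun x => w x i) univ := fun i =>
      (EuclideanSpace.proj i : EuclideanSpace ℝ (Fin 3) →L[ℝ] ℝ).comp_analyticOnNhd han
    have heq : (fun x => ‖w x‖ ^ 2) = fun x => ∑ i, w x i * w x i := by
      funext x
      rw [EuclideanSpace.norm_eq, Real.sq_sqrt (Finset.sum_nonneg fun i _ => sq_nonneg _)]
      exact Finset.sum_congr rfl fun i _ => by rw [Real.norm_eq_abs, sq_abs, sq]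
    rw [heq]
    exact Finset.analyticOnNhd_fun_sum _ fun i _ => (hcoord i).mul (hcoord i)
  -- constant `1` near `x₀`, hence everywhere
  have hev : (fun x => ‖w x‖ ^ 2) =ᶠ[𝓝 x₀] fun _ => (1 : ℝ) := by
    filter_upwards [mem_interior_iff_mem_nhds.1 hx₀] with x hx
    have hx' : ‖w x‖ = 1 := hx
    rw [hx', one_pow]
  have hconst : (fun x => ‖w x‖ ^ 2) = fun _ => (1 : ℝ) := hsq.eq_of_eventuallyEq analyticOnNhd_const hev
  intro x
  have h2 : ‖w x‖ ^ 2 = 1 := congrFun hconst x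
  nlinarith [norm_nonneg (w x), hw1 x]

/-- R2 — analytic rigidity of the plateau: ★ PROVED in REV 1.1 (`analyticRigidity_holds`); kept under its registered name. -/
theorem stub_analyticRigidity : AnalyticRigidity := analyticRigidity_holds

/-- **R3 PROVED (REV 1.1) — full-ball transfer.**  Locally uniform convergence of the normalised re-centred members to a field of
constant speed `1` (radius `r`, tolerance `δ`) puts the WHOLE ball `B(y n, r·L n)` inside the near-top set `{‖v n‖ ≥ (1−δ)M n}`, and
`|B(y n, r L n)| = (4π/3)(r L n)³ ≥ (r L n)³` (`EuclideanSpace.volume_ball_fin_three`). [folklore] -/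
theorem fullBallTransfer_holds : FullBallTransfer := by
  intro v M L y w r δ hr hδ hM hL hconv hconst
  filter_upwards [hconv r δ hr hδ] with n hn
  have hsub : Metric.ball (y n) (r * L n) ⊆
      {x : E3 | x ∈ Metric.ball (y n) (r * L n) ∧ (1 - δ) * M n ≤ ‖v n x‖} := by
    intro x hx
    refine ⟨hx, ?_⟩
    set z : E3 := (L n)⁻¹ • (x - y n) with hz
    have hzx : y n + L n • z = x := by
      rw [hz, smul_smul, mul_inv_cancel₀ (hL n).ne', one_smul, add_sub_cancel]
    have hzr : z ∈ Metric.closedBall (0 : E3) r := by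
      rw [Metric.mem_closedBall, dist_zero_right, hz, norm_smul, norm_inv, Real.norm_eq_abs, abs_of_pos (hL n),
        inv_mul_le_iff₀ (hL n)]
      rw [Metric.mem_ball, dist_eq_norm] at hx
      linarith
    have h1 := hn z hzr
    rw [hzx] at h1
    have h2 : 1 - δ ≤ ‖(M n)⁻¹ • v n x‖ := by
      have h3 := norm_sub_norm_le (w z) ((M n)⁻¹ • v n x)
      rw [hconst z, norm_sub_rev] at h3
      linarith
    rw [norm_smul, norm_inv, Real.norm_eq_abs, abs_of_pos (hM n), le_inv_mul_iff₀ (hM n)] at h2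
    linarith
  calc ENNReal.ofReal ((r * L n) ^ 3) ≤ volume (Metric.ball (y n) (r * L n)) := by
        rw [EuclideanSpace.volume_ball_fin_three, ← ENNReal.ofReal_pow (mul_pos hr (hL n)).le]
        calc ENNReal.ofReal ((r * L n) ^ 3) = ENNReal.ofReal ((r * L n) ^ 3) * 1 := (mul_one _).symm
          _ ≤ ENNReal.ofReal ((r * L n) ^ 3) * ENNReal.ofReal (Real.pi * 4 / 3) := by
              gcongr
              rw [ENNReal.one_le_ofReal]
              nlinarith [Real.pi_gt_three]
    _ ≤ volume {x : E3 | x ∈ Metric.ball (y n) (r * L n) ∧ (1 - δ) * M n ≤ ‖v n x‖} := measure_mono hsub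

/-- R3 — full-ball transfer: ★ PROVED in REV 1.1 (`fullBallTransfer_holds`); kept under its registered name. -/
theorem stub_fullBallTransfer : FullBallTransfer := fullBallTransfer_holds

/-- R4 — analytic slice transfer (M/L; re-run of the landed 28318 at an analytic budget). [folklore] -/
theorem stub_analyticSliceTransfer : AnalyticSliceTransfer := by
  sorry

/-! ### Registered-stub aliases -/
namespace Registered
/-- Statement of registered stub P1 (REV 1.2). -/
abbrev stub_rootedContact : Prop := RootedContact
/-- Statement of registered stub R1′ (REV 1.2). -/
abbrev stub_lawBookkeeping : Prop := LawBookkeeping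
/-- Statement of the (now derived) R1. -/
abbrev stub_meanContact : Prop := MeanContact
/-- Statement of registered stub R2. -/
abbrev stub_analyticRigidity : Prop := AnalyticRigidity
/-- Statement of registered stub R3. -/
abbrev stub_fullBallTransfer : Prop := FullBallTransfer
/-- Statement of registered stub R4. -/
abbrev stub_analyticSliceTransfer : Prop := AnalyticSliceTransfer
end Registered

/-! ## §3 Compositions (real proofs, no `sorry` below this line) -/

/-- From the non-degeneracy clause `0 < M·√Z·√W`: `0 < M` and `0 < λ(v)`. -/
theorem pos_of_nondeg {v : E3 → E3} {M : ℝ}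
    (h : 0 < M * Real.sqrt (Zen v) * Real.sqrt (Wpa v)) : 0 < M ∧ 0 < lam v := by
  have hZ0 : 0 ≤ Real.sqrt (Zen v) := Real.sqrt_nonneg _
  have hW0 : 0 ≤ Real.sqrt (Wpa v) := Real.sqrt_nonneg _
  have hMZ : 0 < M * Real.sqrt (Zen v) := by
    by_contra hle
    push Not at hle
    have : M * Real.sqrt (Zen v) * Real.sqrt (Wpa v) ≤ 0 := mul_nonpos_of_nonpos_of_nonneg hle hW0
    linarith
  have hW : 0 < Real.sqrt (Wpa v) := by
    rcases hW0.eq_or_lt with h0 | h0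
    · rw [← h0, mul_zero] at h; exact absurd h (lt_irrefl 0)
    · exact h0
  have hM : 0 < M := by
    by_contra hle
    push Not at hle
    have : M * Real.sqrt (Zen v) ≤ 0 := mul_nonpos_of_nonpos_of_nonneg hle hZ0
    linarith
  have hZ : 0 < Real.sqrt (Zen v) := by
    rcases hZ0.eq_or_lt with h0 | h0
    · rw [← h0, mul_zero] at hMZ; exact absurd hMZ (lt_irrefl 0)
    · exact h0
  exact ⟨hM, Real.sqrt_pos.2 (div_pos (Real.sqrt_pos.1 hZ) (Real.sqrt_pos.1 hW))⟩

/-- The analytic-budget case is LITERALLY a special case of the crux (28317): definitional match of the tree's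
abbreviations with the crux's clauses.  (So the line is not stronger than the crux at the static node.) -/
theorem analyticRNPS_of_rnps
    (h : Summit.NavierStokesRegularity.NavierStokesRegularity.Theses.ExtremiserTransience.RegularisedNearPlateauStability) :
    AnalyticRNPS := by
  intro A hA _hAn
  obtain ⟨c₀, r, hc₀, hr, H⟩ := h A hA
  refine ⟨c₀, r, hc₀, hr, fun δ hδ => ?_⟩
  obtain ⟨ε, hε, Hε⟩ := H δ hδ
  refine ⟨ε, hε, fun v M B hadm hreg hpos heff => ?_⟩
  obtain ⟨hv, hdiv, hM, hB, h0, h1, h2⟩ := hadm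
  exact Hε v M B hv hdiv hM hB h0 h1 h2 hreg hpos heff

/-- **R1 → R2 → R3 → `AnalyticRNPS`.**  With `c₀ = r = 1`: if for some margin `δ` no defect `ε` worked, violators with
`ε = 1/(n+1)` would (R1) have a local limit with a plateau with interior, of constant speed by analytic rigidity (R2),
and the violators' near-top sets would fill whole balls (R3) — contradiction. -/
theorem analyticRNPS_of
    (h1 : Registered.stub_meanContact) (h2 : Registered.stub_analyticRigidity)
    (h3 : Registered.stub_fullBallTransfer) : AnalyticRNPS := by
  have h1' : MeanContact := h1
  have h2' : AnalyticRigidity := h2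
  have h3' : FullBallTransfer := h3
  intro A hA hAn
  refine ⟨1, 1, one_pos, one_pos, ?_⟩
  intro δ hδ
  by_contra hcon
  push Not at hcon
  -- violators with defect `1/(n+1)`
  have hc : ∀ n : ℕ, ∃ (v : E3 → E3) (M B : ℝ), IsAdm v M B ∧ IsReg A v M ∧
      0 < M * Real.sqrt (Zen v) * Real.sqrt (Wpa v) ∧
      (kStar - 1 / ((n : ℝ) + 1)) * M * Real.sqrt (Zen v) * Real.sqrt (Wpa v) ≤ |Jst v| ∧
      ∀ x₀ : E3, volume {x : E3 | x ∈ Metric.ball x₀ (1 * lam v) ∧ (1 - δ) * M ≤ ‖v x‖} <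
        ENNReal.ofReal (1 * (1 * lam v) ^ 3) := by
    intro n
    have hεn : (0 : ℝ) < 1 / ((n : ℝ) + 1) := by positivity
    obtain ⟨v, M, B, hadm, hreg, hpos, heff, hviol⟩ := hcon (1 / ((n : ℝ) + 1)) hεn
    exact ⟨v, M, B, hadm, hreg, hpos, heff, hviol⟩
  choose v M B hadm hreg hpos heff hviol using hc
  -- R1: a local limit with a plateau with interior
  obtain ⟨φ, y, w, hφ, hwc, hw1, hwA, hwint, hconv⟩ := h1' A hA hAn v M B (fun n => 1 / ((n : ℝ) + 1)) hadm hreg hpos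
    tendsto_one_div_add_atTop_nhds_zero_nat heff
  -- R2: constant speed
  have hconst : ∀ x, ‖w x‖ = 1 := h2' A w hAn hwc hwA hw1 hwint
  -- R3: whole balls
  have hMpos : ∀ n, 0 < M (φ n) := fun n => (pos_of_nondeg (hpos (φ n))).1
  have hLpos : ∀ n, 0 < lam (v (φ n)) := fun n => (pos_of_nondeg (hpos (φ n))).2
  have hev := h3' (fun n => v (φ n)) (fun n => M (φ n)) (fun n => lam (v (φ n))) y w 1 δ one_pos hδ
    hMpos hLpos hconv hconst
  obtain ⟨n, hn⟩ := hev.exists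
  have hlt := hviol (φ n) (y n)
  simp only [one_mul] at hn hlt
  exact absurd hn (not_le.2 hlt)

/-- **COMPOSITION FOR THE CRUX (kernel-checked).**  R1 → R2 → R3 → R4 → `NearExtremalTransiencePerFlow` (26567, BY
NAME): the analytic-budget stability gives the slice object along every Type-I singular flow failing depletion (R4),
which the LANDED `plateauSliceRigidity` (27823) refutes. -/
theorem NearExtremalTransiencePerFlow_of
    (h1 : Registered.stub_meanContact) (h2 : Registered.stub_analyticRigidity)
    (h3 : Registered.stub_fullBallTransfer) (h4 : Registered.stub_analyticSliceTransfer) :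
    Summit.NavierStokesRegularity.NavierStokesRegularity.Theses.ExtremiserTransience.NearExtremalTransiencePerFlow := by
  have h4' : AnalyticSliceTransfer := h4
  have hX : SliceObject := h4' (analyticRNPS_of h1 h2 h3)
  intro C ν T hC hν hT0 u p hcl hLH hdec hrate hnoext
  by_contra hno
  exact plateauSliceRigidity (hX C ν T hC hν hT0 u p hcl hLH hdec hrate hnoext hno)

/-- **COMPOSITION FOR THE CRUX FROM THE REV 1.2 STUB SET (kernel-checked): P1 → R1′ → R4 → (26567) BY NAME**, the
analytic rigidity R2 and the full-ball transfer R3 being theorems of this file since REV 1.1. -/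
theorem NearExtremalTransiencePerFlow_of_rooted
    (hP : Registered.stub_rootedContact) (hL : Registered.stub_lawBookkeeping)
    (h4 : Registered.stub_analyticSliceTransfer) :
    Summit.NavierStokesRegularity.NavierStokesRegularity.Theses.ExtremiserTransience.NearExtremalTransiencePerFlow := by
  have hP' : RootedContact := hP
  have hL' : LawBookkeeping := hL
  exact NearExtremalTransiencePerFlow_of (hL' hP') analyticRigidity_holds fullBallTransfer_holds h4

/-- Sanity: the skeleton's hypotheses are exactly the three registered stubs of REV 1.2 (P1, R1′, R4). -/
example : Summit.NavierStokesRegularity.NavierStokesRegularity.Theses.ExtremiserTransience.NearExtremalTransiencePerFlow :=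
  NearExtremalTransiencePerFlow_of_rooted stub_rootedContact stub_lawBookkeeping stub_analyticSliceTransfer

end Summit.NavierStokesRegularity.NavierStokesRegularity.Cruxes.NearExtremalTransience.ExtremalLaw

end
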